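import Mathlib.NumberTheory.FLT.MasonStothers
import Literature.NumberTheory.EllipticCurves.GeometricSzpiro
import Literature.NumberTheory.EllipticCurves.Szpiro
import Literature.NumberTheory.DiophantineGeometry.FaltingsHeightProofs
import Literature.Barriers.ABC.NoArithmeticDerivativeSmallDerivativesProofs
import Literature.Barriers.ABC.SzpiroEpsilonCannotBeDroppedHolds
import Literature.NumberTheory.EllipticCurves.DegreeConjectureAbc
import Summits.ABC.ABC.Statement
import HarnessLib
import HarnessLib.Audit

/-!
# Cell abc-ff — the function-field TRANSFER SHEET for Szpiro / abc (typed requirements, NOT results)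

`Summits/ABC/FunctionField/TransferSheet.lean`, namespace `Summit.ABC.FunctionField` (cell abc-ff,
seat typ-1; schema `run/shared/lean/pub/abc-ff/plan/SPEC.md`, row ids and page locators in the cell's
`plan/SHEET.md`, which is the source of truth for every citation below). HONESTY: abc is not proved
by any of this. Rung A-PS (polynomial Szpiro, `|Δ_min(E)| ≤ C·N(E)^K` for all `E/ℚ`, fixed `K`) is
NOT abc — «NOT abc — POLY-SZPIRO(E)» (D-0139); full abc / Szpiro `6+ε` (rung A0) is the main goal
(D-0140). Typed ≠ proved; a primary is a source, not an endorsement; quoting ≠ agreeing; no side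
is taken on [IUTchIII] Cor. 3.12 (`Literature.Barriers.ABC.IUTDisputedClaim`).

## §1 The side that works (function fields): theorems of record, cited BY NAME
* (c) Mason–Stothers: Mathlib `Polynomial.abc` (re-exported as
  `Literature.NumberTheory.DiophantineGeometry.mason_stothers`): coprime `a + b + c = 0` in `k[X]`
  ⇒ `max deg + 1 ≤ deg rad(abc)` or `a′ = b′ = c′ = 0` — exponent EXACTLY `1`, constant `−1`
  (rows MS-1…MS-6; MS-5 `Polynomial.natDegree_wronskian_lt_add` is the step that carries it). The
  characteristic-`p` disjunct is necessary: `Literature.Barriers.ABC.MasonStothersFailsInCharP`.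
* (a) Kodaira–Shioda–Szpiro–Hindry–Silverman:
  `Literature.NumberTheory.EllipticCurves.GeometricSzpiro.geometricSzpiro` (named fact, Silverman
  ATAEC Ex. 3.36(b)): `k = k̄`, char `0`, `E/k(C)` not split ⇒
  `deg 𝔇_{E/K} ≤ 6 · deg 𝔣_{E/K} + 12 (g − 1)` — exponent EXACTLY `6 = 12/2` (rows KS-1…KS-6:
  KS-1 Noether `deg 𝔇 = 12 deg ω` carries the `12`, KS-3 `2 deg ω ≤ 2g − 2 + s` the `÷2`;
  `ks_bookkeeping` below), no `ε`, all places including `∞`, conductor form (the `s`-form needs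
  semistability; Szpiro 1990 Thm 1).
* (b) Bogomolov (ABKP 2000 §5; Zhang 2001; Mochizuki 2016 «Bogomolov's proof…») and Parshin's
  «arithmetic BMY ⇒ height conjecture»: words only (rows B-1…B-5, P-1…P-3) — Mathlib has no
  `SL₂(ℤ)~`-length / arithmetic-surface Chern numbers; the naive one-constant arithmetic BMY is
  refuted in print (Bost–Mestre–Moret-Bailly 1990), Parshin's three-constant form is untyped.

## §2 Dictionary (rows D-1…D-8): `deg ↔ log`; `2g − 2 ↔ log|D_K|` (`= 0` over `ℚ`);
`deg 𝔣 = Σ f_v deg v ↔ log N_E` (`WeierstrassCurve.conductorNorm ℤ`); `deg 𝔇_min ↔ log|Δ_min|`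
(`WeierstrassCurve.minimalDiscriminantNorm ℤ`); `deg ω ↔ h_F(E)` (`WeierstrassCurve.faltingsHeight`);
Noether `deg 𝔇 = 12 deg ω` ↔ `log|Δ_min| < 12 h_F + 16` (THEOREM:
`WeierstrassCurve.log_minimalDiscriminantNorm_lt_faltingsHeight_holds`, Pasten 2024 Lemma 18.1 /
Silverman 1986); `Ω¹_C(log S)` / `dφ ≠ 0` ↔ NONE (`Literature.Barriers.ABC.IntegersHaveNoDerivation`);
exactness (`ε = 0`) ↔ FALSE over `ℚ` (`Literature.Barriers.ABC.EpsilonCannotBeDropped`,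
`…SzpiroEpsilonCannotBeDropped`; `not_rksPolar_zero` below).

## §3 The FIRST NON-TRANSFERRING STEP of each chain and its typed replacement `R` (proof-free Props)
* KS-2/KS-3 (the Kodaira–Spencer map and its degree inequality) ↦ `RKS` («Szpiro for the Faltings
  height», Frey's (H): `12 h_F ≤ (6+ε) log N + C`) and the fixed-loss `RKSPolar lam`.
  STRENGTH: `RKS ⟺ ABC` (RESTATEMENT class, kernel certificate `rks_iff_abc` in the sibling file
  `TransferSheetStrength.lean`, after referee B); `RKSPolar lam ⟹ PolySzpiroWith (6 + lam)`
  (`polySzpiroWith_of_rksPolar`, here) = «NOT abc — POLY-SZPIRO(6+λ)», and `RKSPolar 0` is FALSE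
  (`not_rksPolar_zero`, here). PATH: `lam → 0⁺` (`rks_iff_forall_rksPolar`). IUT locus: HAT's
  «arithmetic Kodaira–Spencer morphism» / [IUTchIV] Thm 1.10 — CLAIMED, disputed, no side taken.
* MS-5 (degree drop of the Wronskian) ↦ Pasten's Small Derivatives Conjecture with exponent `η`,
  `Literature.Barriers.ABC.Pasten.SmallDerivativesConjectureWith η` (cited by name, not restated),
  and its `η → 0⁺` envelope `SmallDerivativesAllExponents`. STRENGTH: fixed `η ∈ (0,1)` ⟹ POLY-abc
  with every exponent `M > 1/(1−η)` (`polyAbc_of_smallDerivatives` here = tree Lemma 4.1; the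
  quantitative form and `SmallDerivativesAllExponents → ABC` are in `TransferSheetMason.lean`);
  `η ≤ 0` is FALSE as typed. PATH: `η → 0⁺`. EFFECTIVE: no («all but finitely many»).
* B-2 ∧ B-4 / P-1 ↦ `R_B`, `R_P`: untyped (see §1(b)); census rows filed as words by the plan seat.

## §4 Skeletons (sorry-free): `szpiro_of_rks : RKS → SzpiroConjecture` (hypothesis-free — the
dictionary row it consumes is a theorem), `polySzpiroWith_of_rksPolar`, `polySzpiro_of_rksPolar`
(A-PS as displayed on the ladder), `polyAbc_of_smallDerivatives`. What each consumes is named in its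
docstring. Deliberately NOT here: any restatement of `SzpiroConjecture`/`ABC`/Pasten's conjecture;
any free-floating record of «surface invariants» (vacuity); the A-PS sub-summit Prop, which the A1
cell types (`Summit.ABC.PolySzpiroRat`, cited by name once it lands — until then the `∃ K C`
sentence is displayed inline).
-/

noncomputable section

open WeierstrassCurve NumberField
open Literature.NumberTheory.EllipticCurves Literature.NumberTheory.DiophantineGeometry

namespace Summit.ABC.FunctionField

/-! ## §1 Exponent bookkeeping of the function-field proofs (rows KS-1/KS-3/KS-5 and KS-6) -/

/-- **Where the `6` comes from (rows KS-1, KS-3 ⇒ KS-5):** Noether `deg 𝔇 = 12 · deg ω` and the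
Kodaira–Spencer degree inequality `2 · deg ω ≤ 2g − 2 + s` give `deg 𝔇 ≤ 6 (2g − 2 + s)`;
`6 = 12 / 2` = weight of `Δ` over weight of `Ω¹`. Pure bookkeeping over `ℤ`, for referee A's
exponent re-derivation; the geometric inputs are rows of the sheet, not hypotheses about surfaces.
[folklore] -/
theorem ks_bookkeeping (dDisc dOmega g s : ℤ) (noether : dDisc = 12 * dOmega)
    (ks : 2 * dOmega ≤ 2 * g - 2 + s) : dDisc ≤ 6 * (2 * g - 2 + s) := by
  omega

/-- **Where the `6` comes from in the Riemann–Hurwitz variant (row KS-6; Frey 1987, Remark p. 33):**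
for the `j`-map of degree `d` with ramification `≡ 0 (3)` over `j = 0`, `≡ 0 (2)` over `1728` and
`d − s` over `∞`, Riemann–Hurwitz `2g − 2 ≥ −2d + (d − d/3) + (d − d/2) + (d − s)` gives
`d ≤ 6 (2g − 2 + s)`: `1/6 = 1 − 1/2 − 1/3`. Bookkeeping over `ℚ`. [folklore] -/
theorem hurwitz_bookkeeping (d g s : ℚ)
    (rh : -2 * d + (d - d / 3) + (d - d / 2) + (d - s) ≤ 2 * g - 2) : d ≤ 6 * (2 * g - 2 + s) := by
  linarith

/-! ## §3 Replacement statements (conjectural requirements — NOT Literature facts, NOT results) -/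

/-- **Row CF-1 — `R_KS`, «Szpiro for the Faltings height»** (the output an arithmetic
Kodaira–Spencer inequality would have to deliver; Frey 1987, Sém. Théorie des Nombres Paris 1985–86,
p. 33, conjecture (H)*_d with `d = 1`: `h(E) ≤ c(ε) + (1/2 + ε) log N`, «true for elliptic curves
over function fields» loc. cit.): for every `ε > 0` there is `C` with
`12 · h_F(E/ℚ) ≤ (6 + ε) · log N_E + C` for every elliptic curve over `ℚ`
(`h_F = WeierstrassCurve.faltingsHeight`, `N_E = conductorNorm ℤ`). CONJECTURAL REPLACEMENT
STATEMENT, open; STRENGTH «= abc» (RESTATEMENT: referee B's kernel certificate `rks_iff_abc`, landed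
separately as `TransferSheetStrength.lean`); used only as a hypothesis. D-0139/D-0140: a requirement row, not a claim. [folklore] -/
@[conjecture] def RKS : Prop :=
  ∀ ε : ℝ, 0 < ε → ∃ C : ℝ, ∀ (W : WeierstrassCurve ℚ) [W.IsElliptic],
    12 * W.faltingsHeight ≤ (6 + ε) * Real.log (W.conductorNorm ℤ : ℝ) + C

/-- **Row CF-2 — `R_KSλ`, the fixed-loss version** (Frey's (H)*_d with `6d = 6 + λ`): ONE `λ` and
one `C` with `12 · h_F(E/ℚ) ≤ (6 + λ) · log N_E + C` for all `E/ℚ` — the output of an arithmetic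
Kodaira–Spencer map whose archimedean/polar defect is `≤ (λ/2) log N_E + O(1)`. CONJECTURAL for
every `λ > 0` («NOT abc — POLY-SZPIRO(6 + λ)», `polySzpiroWith_of_rksPolar`); FALSE for `λ = 0`
(`not_rksPolar_zero`, Masser 1990); implied by abc for `λ > 0`. The parameter is spelled `lam`.
[folklore] -/
@[conjecture] def RKSPolar (lam : ℝ) : Prop :=
  ∃ C : ℝ, ∀ (W : WeierstrassCurve ℚ) [W.IsElliptic],
    12 * W.faltingsHeight ≤ (6 + lam) * Real.log (W.conductorNorm ℤ : ℝ) + C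

/-- `R_KS` is literally «`R_KSλ` for every `λ > 0`» — the PATH cell of row CF-2 (`λ → 0⁺`).
[folklore] -/
theorem rks_iff_forall_rksPolar : RKS ↔ ∀ lam : ℝ, 0 < lam → RKSPolar lam := Iff.rfl

/-- **POLY-SZPIRO with exponent `K` (logarithmic form)** — the A-PS SHAPE «NOT abc —
POLY-SZPIRO(K)» (D-0139): one `C` with `log|Δ_min(E)| ≤ K · log N_E + C` for all elliptic `E/ℚ`
(Szpiro 1990, Astérisque 183, Conjecture 1: `N(Δ_E) < N(N_E)^{a(K)}`, Szpiro's original «undetermined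
exponent» form; SHEET F8). Parametric bookkeeping shape only; the sub-summit Prop `∃ K, …` is the A1
cell's `Summit.ABC.PolySzpiroRat` (not restated here). [folklore] -/
@[conjecture] def PolySzpiroWith (K : ℝ) : Prop :=
  ∃ C : ℝ, ∀ (W : WeierstrassCurve ℚ) [W.IsElliptic],
    Real.log (W.minimalDiscriminantNorm ℤ : ℝ) ≤ K * Real.log (W.conductorNorm ℤ : ℝ) + C

/-- **Generalized POLY-SZPIRO with exponent `K`** (Bombieri–Gubler Conj. 12.5.11 shape with
`6 + ε ↦ K`, the `j`-part `|c₄|³` included): `max(|Δ|, |c₄|³) ≤ C · N^K` on global minimal models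
over `ℤ`. For `K = 6 + ε` (all `ε`) this is `GeneralizedSzpiroConjectureBG` `⟺ abc`
(`abcLe_iff_generalizedSzpiroBG_holds`); for fixed `K` it gives POLY-abc with exponent `K/6` through
the Frey curve («NOT abc»). Bookkeeping shape for the STRENGTH cell of CF-2
(`genPolySzpiroWith_of_rksPolar`, sibling file). [folklore] -/
@[conjecture] def GenPolySzpiroWith (K : ℝ) : Prop :=
  ∃ C : ℝ, ∀ W₀ : WeierstrassCurve ℤ, (W₀.baseChange ℚ).IsElliptic →
    (∀ v : IsDedekindDomain.HeightOneSpectrum ℤ, (W₀.baseChange ℚ).IsMinimalAt v) →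
      ((max |W₀.Δ| (|W₀.c₄| ^ 3) : ℤ) : ℝ) ≤ C * ((W₀.baseChange ℚ).conductorNorm ℤ : ℝ) ^ K

/-- **POLY-abc with exponent `M`** (Oesterlé's form of abc with an unspecified exponent — Pasten
2021 Conj. 3.2 shape, with a constant): `c ≤ C · rad(abc)^M` for all abc triples. For `M = 1 + ε`
(all `ε`) this is the summit `ABC` (up to `<`/`≤`, `ABC_iff`, `abcLt_of_abcLe`); for fixed `M` it is
the A-PS-side currency of the Mason chain («NOT abc»; ⇒ POLY-SZPIRO(`6M/(6−5M)`) only for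
`M < 6/5`, Silverman AEC VIII.11.5(b) elimination). [folklore] -/
@[conjecture] def PolyAbcWith (M : ℝ) : Prop :=
  ∃ C : ℝ, ∀ a b c : ℕ, IsABCTriple a b c → (c : ℝ) ≤ C * ((rad a b c : ℕ) : ℝ) ^ M

/-- Regression: the generalized Szpiro conjecture of Bombieri–Gubler (`⟺ abc` in the tree) is literally
«`GenPolySzpiroWith (6 + ε)` for every `ε > 0`». [folklore] -/
theorem generalizedSzpiroBG_iff_forall_genPolySzpiroWith :
    GeneralizedSzpiroConjectureBG ↔ ∀ ε : ℝ, 0 < ε → GenPolySzpiroWith (6 + ε) := Iff.rfl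

/-- Regression: the summit `ABC` is «`PolyAbcWith (1 + ε)` for every `ε > 0`» (strict form with
`0 < C` versus `≤`-form: `ABC_iff`, `abcLt_of_abcLe`). [folklore] -/
theorem abc_iff_forall_polyAbcWith : _root_.ABC ↔ ∀ ε : ℝ, 0 < ε → PolyAbcWith (1 + ε) := by
  refine ⟨fun h ε hε => ?_, fun h => ABC_iff.mpr (abcLt_of_abcLe h)⟩
  obtain ⟨C, -, hC⟩ := ABC_iff.mp h ε hε
  exact ⟨C, fun a b c habc => (hC a b c habc).le⟩

/-- **Row CF-3 envelope — `R_MS(0⁺)`: Pasten's Small Derivatives Conjecture for EVERY exponent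
`η > 0`** (`Literature.Barriers.ABC.Pasten.SmallDerivativesConjectureWith η`, cited by name; Pasten
2021 Conj. 3.9 asks for ONE `η < 1`; `η > 1` is a theorem, `smallDerivativesConjectureWith_of_one_lt`).
CONJECTURAL REPLACEMENT STATEMENT for the Wronskian degree drop (row MS-5), open; STRENGTH A0:
it implies `ABC` (`abc_of_smallDerivativesAllExponents`, sibling file `TransferSheetMason.lean`),
while abc is only known to give `η > 1 − (2 − M)/(4M)` (Pasten Thm. 4.5), so it is not known to be
a restatement. PATH: a power saving over the Bombieri–Vaaler bound `‖ψ‖ ≤ ω(abc) c log c / (2 log 2)`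
(`Pasten.exists_adapted_independent_holds`). EFFECTIVE: no. Barrier: `η = 0` / polylog losses are
refuted as typed (`Literature.Barriers.ABC.EpsilonCannotBeDropped`). D-0139/D-0140: a requirement
row, not a claim. [folklore] -/
@[conjecture] def SmallDerivativesAllExponents : Prop :=
  ∀ η : ℝ, 0 < η → Literature.Barriers.ABC.Pasten.SmallDerivativesConjectureWith η

/-! ## §4 Skeletons (sorry-free; each names the sheet rows it consumes) -/

/-- Dictionary row D-5 over `ℚ`, as used by the skeletons: `log|Δ_min(E)| < 12 h_F(E/ℚ) + 16`
for every elliptic `W/ℚ` — the tree's discharged fact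
`WeierstrassCurve.log_minimalDiscriminantNorm_lt_faltingsHeight_holds` (Pasten 2024, Lemma 18.1)
at `L = ℚ`, read over `ℤ` via `minimalDiscriminantNorm_ringOfIntegers_rat_holds`.
(The function-field row is the EQUALITY `deg 𝔇 = 12 deg ω`.) [cite: PastenShimura2024, Lemma 18.1] -/
theorem log_minimalDiscriminantNorm_lt (W : WeierstrassCurve ℚ) [W.IsElliptic] :
    Real.log (W.minimalDiscriminantNorm ℤ : ℝ) < 12 * W.faltingsHeight + 16 := by
  have h1 := log_minimalDiscriminantNorm_lt_faltingsHeight_holds W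
  rwa [minimalDiscriminantNorm_ringOfIntegers_rat_holds W, Module.finrank_self, Nat.cast_one,
    inv_one, one_mul] at h1

/-- **Skeleton CF-2 (consumes D-5 and `R_KSλ`): `R_KSλ ⟹ POLY-SZPIRO(6 + λ)`** with the SAME
exponent and constant `C + 16`; unconditional apart from the requirement itself. For `λ > 0` the
conclusion is «NOT abc — POLY-SZPIRO(6 + λ)» at all heights. [folklore] -/
theorem polySzpiroWith_of_rksPolar {lam : ℝ} (h : RKSPolar lam) : PolySzpiroWith (6 + lam) := by
  obtain ⟨C, hC⟩ := h
  refine ⟨C + 16, fun W _ => ?_⟩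
  have h1 := log_minimalDiscriminantNorm_lt W
  have h2 := hC W
  linarith

/-- **A-PS as displayed on the ladder** (`∃ K C, ∀ E/ℚ, log|Δ_min(E)| ≤ K · log N(E) + C`; the
named Prop is the A1 cell's `Summit.ABC.PolySzpiroRat`, to be cited by name once it lands) **from
`R_KSλ`**, `K = 6 + λ`. «NOT abc — POLY-SZPIRO(6 + λ)». [folklore] -/
theorem polySzpiro_of_rksPolar {lam : ℝ} (h : RKSPolar lam) :
    ∃ K C : ℝ, ∀ (W : WeierstrassCurve ℚ) [W.IsElliptic],
      Real.log (W.minimalDiscriminantNorm ℤ : ℝ) ≤ K * Real.log (W.conductorNorm ℤ : ℝ) + C :=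
  ⟨6 + lam, polySzpiroWith_of_rksPolar h⟩

/-- From the logarithmic to the displayed multiplicative shape: `PolySzpiroWith K` gives
`|Δ_min| ≤ e^C · N^K` (real power). [folklore] -/
theorem minimalDiscriminantNorm_le_of_polySzpiroWith {K : ℝ} (h : PolySzpiroWith K) :
    ∃ C : ℝ, 0 < C ∧ ∀ (W : WeierstrassCurve ℚ) [W.IsElliptic],
      (W.minimalDiscriminantNorm ℤ : ℝ) ≤ C * (W.conductorNorm ℤ : ℝ) ^ K := by
  obtain ⟨C, hC⟩ := h
  refine ⟨Real.exp C, Real.exp_pos C, fun W _ => ?_⟩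
  have hNpos : 0 < (W.conductorNorm ℤ : ℝ) := by exact_mod_cast W.conductorNorm_pos_holds
  have h1 := hC W
  by_cases hD : W.minimalDiscriminantNorm ℤ = 0
  · rw [hD, Nat.cast_zero]
    exact mul_nonneg (Real.exp_pos _).le (Real.rpow_nonneg hNpos.le K)
  have hDpos : 0 < (W.minimalDiscriminantNorm ℤ : ℝ) := by exact_mod_cast Nat.pos_of_ne_zero hD
  have h2 := Real.exp_le_exp.mpr h1
  rw [Real.exp_log hDpos, Real.exp_add, mul_comm] at h2
  rwa [Real.rpow_def_of_pos hNpos, mul_comm (Real.log _)]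

/-- **Skeleton CF-1 (consumes D-5 and `R_KS`): `R_KS ⟹ SzpiroConjecture` (`6 + ε`)** —
hypothesis-free apart from the requirement: ask `R_KS` for `ε`, add D-5, exponentiate. The
conclusion is the tree's open statement `Literature.NumberTheory.EllipticCurves.SzpiroConjecture`
(Silverman AEC Conj. VIII.11.1), NOT `ABC` (Szpiro ⇒ abc only with exponent `6/5`,
`abc_sixFifths_of_szpiro`); the PATH to `ABC` itself is `rks_iff_abc` (sibling file). [folklore] -/
theorem szpiro_of_rks (h : RKS) : SzpiroConjecture := by
  intro ε hε
  obtain ⟨C, hCpos, hC⟩ :=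
    minimalDiscriminantNorm_le_of_polySzpiroWith (polySzpiroWith_of_rksPolar (h ε hε))
  exact ⟨C, fun W _ => hC W⟩

/-- **The exact transcription is FALSE (row D-8 / CF-2 at `λ = 0`):** there is no `C` with
`12 h_F(E) ≤ 6 log N_E + C` for all `E/ℚ` — by D-5 it would give `|Δ_min| ≤ e^{C+16} N^6`, against
Masser 1990 (`Literature.Barriers.ABC.not_szpiro_epsilon_zero_holds`, barrier
`SzpiroEpsilonCannotBeDropped`, PROVED in the tree). The function-field theorem has `ε = 0`; the
`ε` is what any arithmetic Kodaira–Spencer substitute must pay. [folklore] -/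
theorem not_rksPolar_zero : ¬ RKSPolar 0 := by
  intro h
  obtain ⟨C, -, hC⟩ := minimalDiscriminantNorm_le_of_polySzpiroWith (polySzpiroWith_of_rksPolar h)
  apply Literature.Barriers.ABC.not_szpiro_epsilon_zero_holds
  refine ⟨C, fun W _ => ?_⟩
  have hNpos : 0 < (W.conductorNorm ℤ : ℝ) := by exact_mod_cast W.conductorNorm_pos_holds
  have h1 := hC W
  rw [add_zero] at h1
  calc (W.minimalDiscriminantNorm ℤ : ℝ) ≤ C * (W.conductorNorm ℤ : ℝ) ^ (6 : ℝ) := h1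
    _ = C * (W.conductorNorm ℤ : ℝ) ^ (6 : ℕ) := by
        rw [← Real.rpow_natCast]
        norm_num

/-- **Skeleton CF-3, fixed `η` (consumes MS-1…MS-4, MS-6 = Pasten Thm 3.3 / Lemma 4.1, all in the
tree): Pasten's Small Derivatives Conjecture (some `0 < η < 1`) ⟹ POLY-abc for SOME exponent** —
verbatim the tree's discharged `Pasten.exists_exponent_of_smallDerivatives_holds` (qualitative
`∃ M`; the printed `every M > 1/(1 − η)` with a constant is `polyAbcWith_of_smallDerivativesWith` in
`TransferSheetMason.lean`). «NOT abc» for fixed `η`. [cite: Pasten2021, Lemma 4.1 and Cor. 4.6] -/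
theorem polyAbc_of_smallDerivatives (h : Literature.Barriers.ABC.Pasten.SmallDerivativesConjecture) :
    ∃ M : ℝ, ∀ a b c : ℕ, IsABCTriple a b c → (c : ℝ) < ((rad a b c : ℕ) : ℝ) ^ M :=
  Literature.Barriers.ABC.Pasten.exists_exponent_of_smallDerivatives_holds h

/-- `R_MS(0⁺)` contains Pasten's conjecture (take `η = 1/2`). [folklore] -/
theorem smallDerivativesConjecture_of_allExponents (h : SmallDerivativesAllExponents) :
    Literature.Barriers.ABC.Pasten.SmallDerivativesConjecture :=
  ⟨1 / 2, by norm_num, by norm_num, h (1 / 2) (by norm_num)⟩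

end Summit.ABC.FunctionField

end
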